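import Summits.BirchSwinnertonDyer.BirchSwinnertonDyer.Theorems.AlignedTransportAtTwoMainConjectureOfRankZeroBSDAtTwoFineRoadInfResRel
import HarnessLib

/-!
# Road (b″) netted, stub Limʳ — the DESCENT of statement (A) from an upstairs field to the RELAXED-at-`∞` fine
# Selmer group of `K_∞^{cyc}` (Lim 2017, Lemma 3.2, in kernel form: `p`-torsion inflation–restriction)

Cell `bsd-f1-sign2`, WIDTH-5 attach seat `bsd-line-att-p5` (gen 4) on line `birth` of crux C2
stmt-BirchSwinnertonDyer-22298 `MainConjectureOfRankZeroBSDAtTwo` (route `AlignedTransportAtTwo`, skeleton v6 405a1387,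
registered stub `stub_limRelAtTwo : LimRelAtTwo`); a `--supports 22298 --as helper` file, sequel of att-p4's
`…FineRoadInfRes` / `…FineRoadInfResRel`. HONEST FRAMING: THEOREMS ONLY — no definition, no named fact, no `sorry`;
BSD is NOT proved by any of this.

WHY. The v6 stub Limʳ asks `ℓ₍₂₎(X₀^{rel ∞}(W/ℚ_∞)) = 0` (relaxed at `∞`) from Iwasawa's `μ₂ = 0` of `F = ℚ(W[2], √−1)`.
The tree's printed door (`Lim2017.thm35_at_two_…_divisionField_four`) concludes for the STRICT fine Selmer group over
`ℚ_∞` only, which for `Δ_W > 0` does not control the relaxed one. In print the relaxed statement comes from UPSTAIRS: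
Lim's Thm. 3.5 gives statement (A) over `F^{cyc} = ℚ(W[2], μ_{2^∞})` (no real place), and his Lemma 3.2 descends it —
«`ker α` is contained in `H¹(Δ, W(L^{cyc}))`, which can be easily seen to be cofinitely generated». This file is that
descent, for every number field `K`, prime `p`, elliptic `W/K` and every normal `H ≤ ker χ_p` of finite index in `ker κ`:

* §1 (any topological group) `finite_pTorsion_ker_resOfLe` — **`p`-torsion inflation–restriction**: for `H₁ ≤ H₂`
  normalised, of finite index, `M` discrete with `M[p]` finite and `M^{H₁}/p` finite, the `p`-torsion classes of
  `H¹(H₂, M)` dying on `H₁` are FINITE (explicit crossed homomorphisms, as in att-p4's `finite_ker_resOfLe`, plus the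
  obstruction class `a mod p·M^{H₁}` of `p·ψ = ∂a`); `finite_pTorsion_of_resOfLe_maps` — fibre counting along `res`.
* §2 (number fields) `finite_modN_fixedPoints_geomPrimaryTorsion` (`E[p^∞]^{H}/p` finite: tree
  `finite_modN_of_primary`), `infKer_eq_top_of_le_kerCyclotomicCharacter` and
  `resOfLe_fineRelaxed_mem_strictSelmerGroupOver` (the restriction `Sel₀^{rel ∞}(K_∞) → Sel₀(K̄^H)` is DEFINED for
  `H ≤ ker χ_p`: no real place upstairs, att-p4 `ker_cyclotomicCharacter_inf_decompInf_eq_bot`), and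
  **`finite_pTorsion_fineRelaxed_of_upstairs`**: `Sel₀(K̄^H, E[p^∞])[p]` finite ⟹ `Sel₀^{rel ∞}(K_∞, E[p^∞])[p]` finite.

The dual side (`ℓ_{(p)}(X₀^{rel ∞}) = 0`) and the `K = ℚ`, `p = 2` assembly of Limʳ are in the sibling
`…FineRoadLimRelUpstairs`.

References: M. F. Lim, *Notes on the fine Selmer groups*, Asian J. Math. 21 (2017) = arXiv:1306.2047, §3 Lemma 3.2,
Thm. 3.5; J.-P. Serre, *Galois Cohomology* I §2.6; R. Greenberg, LNM 1716 (1999) §3, §4 p. 106; J. Coates,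
R. Sujatha, Math. Ann. 331 (2005) §3.
-/

set_option autoImplicit false
-- the Theorems namespace of this sub repeats the summit name by design (D-0017 nested layout)
set_option linter.dupNamespace false

noncomputable section

open scoped Classical

namespace Summit.BirchSwinnertonDyer.BirchSwinnertonDyer.Theorems.AlignedTransportAtTwoFineRoad.LimDescent

open Literature.NumberTheory.EllipticCurves Literature.NumberTheory.GaloisRepresentations

universe u

/-! ## §1 Inflation–restriction along a finite-index subgroup, `p`-torsion form -/

section Generic

variable {G : Type u} [Group G] [TopologicalSpace G] [IsTopologicalGroup G]
  {M : Type u} [AddCommGroup M] [DistribMulAction G M] [TopologicalSpace M] [DiscreteTopology M]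

/-- **Inflation–restriction, `p`-torsion form (Lim 2017, proof of Lemma 3.2: «`ker α` is contained in
`H¹(Δ, W(L^{cyc}))`, which can be easily seen to be cofinitely generated»).** Let `H₁ ≤ H₂` be subgroups of a
topological group `G` with `H₁` normalised by `H₂` and of finite index in it, `M` a discrete `G`-module with
continuous orbit maps and finite `p`-torsion, and suppose `N/pN` is finite for `N = M^{H₁}`. Then the `p`-torsion
classes of `H¹(H₂, M)` restricting to `0` in `H¹(H₁, M)` form a FINITE set. (A kernel class is represented by a
crossed homomorphism `ψ` vanishing on `H₁`, constant on `H₁`-cosets with values in `N`; `p·ψ = ∂a` with `a ∈ N`;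
two classes with the same `a mod pN` differ by a `p`-torsion-valued such `ψ`, of which there are finitely many.)
[cite: Lim2017FineSelmer, §3 Lemma 3.2 (arXiv:1306.2047 p. 6)] [cite: SerreGaloisCohomology1997, I §2.6 (inflation–restriction)] -/
theorem finite_pTorsion_ker_resOfLe {H₁ H₂ : Subgroup G} (hle : H₁ ≤ H₂)
    (hnorm : ∀ g ∈ H₂, ∀ h ∈ H₁, g⁻¹ * h * g ∈ H₁) (hind : (H₁.subgroupOf H₂).FiniteIndex)
    (hcont : ∀ m : M, Continuous fun g : G ↦ g • m) (p : ℕ)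
    (hmod : Finite (ModN (FixedPoints.addSubgroup H₁ M) p))
    (htor : Set.Finite {m : M | p • m = 0}) :
    Set.Finite {c : subgroupH1 H₂ M | p • c = 0 ∧ resOfLe M hle c = 0} := by
  set U : Subgroup H₂ := H₁.subgroupOf H₂ with hU
  haveI : U.FiniteIndex := hind
  set N : AddSubgroup M := FixedPoints.addSubgroup H₁ M with hN
  haveI : Finite (ModN N p) := hmod
  haveI : Finite {m : M | p • m = 0} := htor.to_subtype
  set T : Set (subgroupH1 H₂ M) := {c | p • c = 0 ∧ resOfLe M hle c = 0} with hT
  -- Step 1: every kernel class has a representative vanishing on `H₁`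
  have key : ∀ c : T, ∃ ψ : contOneCocycles (discreteTopRep H₂ M),
      oneCocycleClass _ ψ = c.1 ∧ ∀ x : H₁, ψ.1 (Subgroup.inclusion hle x) = 0 := by
    rintro ⟨c, hc⟩
    obtain ⟨z, rfl⟩ := oneCocycleClass_surjective (discreteTopRep H₂ M) c
    obtain ⟨a, ha⟩ := (CocycleCriteria.resOfLe_oneCocycleClass_eq_zero_iff hle z).mp hc.2
    let π : contOneCocycles (discreteTopRep H₂ M) :=
      cobCocycle a ((hcont a).comp continuous_subtype_val)
    have hπ0 : oneCocycleClass _ π = 0 := oneCocycleClass_cobCocycle a _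
    refine ⟨z - π, ?_, fun x ↦ ?_⟩
    · rw [oneCocycleClass_sub, hπ0, sub_zero]
    · change z.1 (Subgroup.inclusion hle x) - (((Subgroup.inclusion hle x : H₂) : G) • a - a) = 0
      rw [ha x, Subgroup.coe_inclusion, sub_self]
  choose ψ hψc hψ0 using key
  -- Step 2: such representatives are constant on `U`-cosets, with values in `N = M^{H₁}`
  have hcoset : ∀ c (g k : H₂), k ∈ U → (ψ c).1 (g * k) = (ψ c).1 g := by
    intro c g k hk
    have hk' : (k : G) ∈ H₁ := Subgroup.mem_subgroupOf.mp hk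
    have h0 : (ψ c).1 k = 0 := by
      have e : Subgroup.inclusion hle ⟨(k : G), hk'⟩ = k := Subtype.ext rfl
      rw [← e]
      exact hψ0 c ⟨(k : G), hk'⟩
    rw [(ψ c).2 g k, h0, map_zero, add_zero]
  have hinv : ∀ c (g : H₂) (h : H₁), h • (ψ c).1 g = (ψ c).1 g := by
    intro c g h
    set h' : H₂ := Subgroup.inclusion hle h with hh'
    have h1 : (ψ c).1 (h' * g) = (discreteTopRep H₂ M).ρ h' ((ψ c).1 g) := by
      rw [(ψ c).2 h' g, hψ0 c h, zero_add]
    have hmem : g⁻¹ * h' * g ∈ U := by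
      rw [hU, Subgroup.mem_subgroupOf]
      exact hnorm g g.2 h h.2
    have h2 : h' * g = g * (g⁻¹ * h' * g) := by group
    rw [h2, hcoset c g _ hmem, discreteTopRep_ρ_apply, Subgroup.smul_def] at h1
    rw [Subgroup.smul_def]
    exact h1.symm
  -- Step 3: `p • ψ_c = ∂ a_c` with `a_c ∈ N`
  have key2 : ∀ c : T, ∃ a : N, ∀ g : H₂, p • (ψ c).1 g = (g : G) • (a : M) - a := by
    intro c
    have h0 : oneCocycleClass (discreteTopRep H₂ M) (p • ψ c) = 0 := by
      rw [← oneCocycleClassₗ_apply, map_nsmul, oneCocycleClassₗ_apply, hψc c]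
      exact c.2.1
    obtain ⟨v, hv⟩ := (oneCocycleClass_eq_zero_iff _ _).mp h0
    have hv' : ∀ g : H₂, p • (ψ c).1 g = (g : G) • v - v := fun g ↦ by
      have h := hv g
      rw [discreteTopRep_ρ_apply, Subgroup.smul_def] at h
      exact h
    have hvN : v ∈ N := by
      rw [hN, FixedPoints.mem_addSubgroup]
      intro h
      have e := hv' (Subgroup.inclusion hle h)
      rw [hψ0 c h, smul_zero, Subgroup.coe_inclusion, eq_comm, sub_eq_zero] at e
      rw [Subgroup.smul_def]
      exact e
    exact ⟨⟨v, hvN⟩, hv'⟩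
  choose a ha using key2
  -- Step 4: the class of `a_c` in `N/pN`; every fibre is finite
  let Φ : T → ModN N p := fun c ↦ Submodule.Quotient.mk (a c)
  have hfib : ∀ q : ModN N p, Finite {c : T // Φ c = q} := by
    intro q
    by_cases hq : ∃ c₀ : T, Φ c₀ = q
    swap
    · haveI : IsEmpty {c : T // Φ c = q} := ⟨fun c ↦ hq ⟨c.1, c.2⟩⟩
      infer_instance
    obtain ⟨c₀, hc₀⟩ := hq
    -- `a_c - a_{c₀} = p • b_c` with `b_c ∈ N`
    have hb : ∀ c : {c : T // Φ c = q}, ∃ b : N, (p : ℤ) • b = a c.1 - a c₀ := by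
      intro c
      have e : Φ c.1 = Φ c₀ := by rw [c.2, hc₀]
      obtain ⟨b, hb⟩ := (Submodule.Quotient.eq _).mp e
      exact ⟨b, by rw [LinearMap.lsmul_apply] at hb; exact hb⟩
    choose b hb using hb
    -- the `p`-torsion-valued cocycle `θ_c = ψ_c - ψ_{c₀} - ∂ b_c`, read on coset representatives
    have hθ : ∀ (c : {c : T // Φ c = q}) (g : H₂),
        p • ((ψ c.1).1 g - (ψ c₀).1 g - ((g : G) • (b c : M) - b c)) = 0 := by
      intro c g
      have e1 := ha c.1 g
      have e2 := ha c₀ g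
      have hbM : p • ((b c : N) : M) = ((a c.1 : N) : M) - ((a c₀ : N) : M) := by
        have h := hb c
        rw [natCast_zsmul] at h
        rw [← AddSubmonoidClass.coe_nsmul, h, AddSubgroupClass.coe_sub]
      have e3 : p • ((g : G) • ((b c : N) : M) - b c) = (g : G) • ((a c.1 : N) : M) - a c.1 -
          ((g : G) • ((a c₀ : N) : M) - a c₀) := by
        rw [smul_sub, smul_comm, hbM, smul_sub]
        abel
      rw [smul_sub, smul_sub, e1, e2, e3]
      abel
    let F : {c : T // Φ c = q} → (H₂ ⧸ U) → {m : M | p • m = 0} := fun c r ↦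
      ⟨(ψ c.1).1 r.out - (ψ c₀).1 r.out - ((r.out : G) • (b c : M) - b c), hθ c r.out⟩
    refine Finite.of_injective F fun c c' hcc' ↦ ?_
    -- the cocycles `ψ_c - ∂ b_c` and `ψ_{c'} - ∂ b_{c'}` agree everywhere
    have hcob : ∀ (c : {c : T // Φ c = q}) (g k : H₂), k ∈ U →
        ((g * k : H₂) : G) • ((b c : N) : M) - b c = (g : G) • ((b c : N) : M) - b c := by
      intro c g k hk
      have hk' : (k : G) ∈ H₁ := Subgroup.mem_subgroupOf.mp hk
      have hfix : (k : G) • ((b c : N) : M) = b c := by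
        have hbN : ∀ h : H₁, h • ((b c : N) : M) = b c := (FixedPoints.mem_addSubgroup H₁ M _).mp (b c).2
        have := hbN ⟨(k : G), hk'⟩
        rwa [Subgroup.smul_def] at this
      rw [Subgroup.coe_mul, mul_smul, hfix]
    have hall : ∀ g : H₂, (ψ c.1).1 g - ((g : G) • ((b c : N) : M) - b c) =
        (ψ c'.1).1 g - ((g : G) • ((b c' : N) : M) - b c') := by
      intro g
      obtain ⟨k, hk⟩ := QuotientGroup.mk_out_eq_mul U g
      have h := congrArg (fun f ↦ ((f (QuotientGroup.mk g) : {m : M | p • m = 0}) : M)) hcc'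
      change (ψ c.1).1 (QuotientGroup.mk g : H₂ ⧸ U).out - (ψ c₀).1 (QuotientGroup.mk g : H₂ ⧸ U).out -
          ((((QuotientGroup.mk g : H₂ ⧸ U).out : H₂) : G) • ((b c : N) : M) - b c) =
        (ψ c'.1).1 (QuotientGroup.mk g : H₂ ⧸ U).out - (ψ c₀).1 (QuotientGroup.mk g : H₂ ⧸ U).out -
          ((((QuotientGroup.mk g : H₂ ⧸ U).out : H₂) : G) • ((b c' : N) : M) - b c') at h
      rw [hk, hcoset c.1 g k k.2, hcoset c₀ g k k.2, hcoset c'.1 g k k.2, hcob c g k k.2,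
        hcob c' g k k.2] at h
      have h' := congrArg (fun m : M ↦ m + (ψ c₀).1 g) h
      simp only at h'
      rw [show (ψ c.1).1 g - (ψ c₀).1 g - ((g : G) • ((b c : N) : M) - b c) + (ψ c₀).1 g =
          (ψ c.1).1 g - ((g : G) • ((b c : N) : M) - b c) by abel,
        show (ψ c'.1).1 g - (ψ c₀).1 g - ((g : G) • ((b c' : N) : M) - b c') + (ψ c₀).1 g =
          (ψ c'.1).1 g - ((g : G) • ((b c' : N) : M) - b c') by abel] at h'
      exact h'
    have hψeq : ψ c.1 - (cobCocycle (G := H₂) ((b c : N) : M) ((hcont _).comp continuous_subtype_val) :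
          contOneCocycles (discreteTopRep H₂ M)) =
        ψ c'.1 - (cobCocycle (G := H₂) ((b c' : N) : M) ((hcont _).comp continuous_subtype_val) :
          contOneCocycles (discreteTopRep H₂ M)) := by
      apply Subtype.ext
      ext g
      change (ψ c.1).1 g - ((g : G) • ((b c : N) : M) - b c) =
        (ψ c'.1).1 g - ((g : G) • ((b c' : N) : M) - b c')
      exact hall g
    have hcl := congrArg (oneCocycleClass (discreteTopRep H₂ M)) hψeq
    rw [oneCocycleClass_sub, oneCocycleClass_sub, oneCocycleClass_cobCocycle, oneCocycleClass_cobCocycle,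
      sub_zero, sub_zero, hψc, hψc] at hcl
    exact Subtype.ext (Subtype.ext hcl)
  haveI : Finite T := Finite.of_equiv _ (Equiv.sigmaFiberEquiv Φ)
  exact Set.toFinite T

/-- **Fibre-counting.** If `f` maps a subset `T` of an additive group into a finite set and any two points of
`T` with the same image differ by an element of a finite set `D`, then `T` is finite. [folklore] -/
theorem finite_of_finite_image_of_sub_mem {α β : Type*} [AddGroup α] {T : Set α} {f : α → β}
    (himg : (f '' T).Finite) {D : Set α} (hD : D.Finite)
    (hfib : ∀ a ∈ T, ∀ a' ∈ T, f a = f a' → a - a' ∈ D) : T.Finite := by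
  -- choose a point of `T` in each fibre
  have hsub : T ⊆ ⋃ b ∈ f '' T, {a ∈ T | f a = b} := by
    intro a ha
    simp only [Set.mem_iUnion, Set.mem_image, Set.mem_setOf_eq, exists_prop]
    exact ⟨f a, ⟨a, ha, rfl⟩, ha, rfl⟩
  refine (himg.biUnion fun b hb ↦ ?_).subset hsub
  obtain ⟨a₀, ha₀, rfl⟩ := hb
  have h2 : {a ∈ T | f a = f a₀} ⊆ (fun d ↦ d + a₀) '' D := by
    intro a ha
    exact ⟨a - a₀, hfib a ha.1 a₀ ha₀ ha.2, by simp⟩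
  exact (hD.image _).subset h2

/-- **Descent of `p`-torsion finiteness along restriction.** Let `S₁ ≤ H¹(H₂, M)` and `S₂ ≤ H¹(H₁, M)` be subgroups
with `res(S₁) ⊆ S₂`. If `S₂[p]` is finite and the `p`-torsion kernel classes of `res : H¹(H₂, M) → H¹(H₁, M)` are
finite, then `S₁[p]` is finite (two classes of `S₁[p]` with the same restriction differ by a `p`-torsion kernel
class). Lim 2017, proof of Lemma 3.2 («The conclusion is now immediate»).
[cite: Lim2017FineSelmer, §3 Lemma 3.2 (arXiv:1306.2047 p. 6)] -/
theorem finite_pTorsion_of_resOfLe_maps {H₁ H₂ : Subgroup G} (hle : H₁ ≤ H₂) (p : ℕ)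
    (S₁ : AddSubgroup (subgroupH1 H₂ M)) (S₂ : AddSubgroup (subgroupH1 H₁ M))
    (hmap : ∀ c ∈ S₁, resOfLe M hle c ∈ S₂)
    (hS₂ : Set.Finite {c : subgroupH1 H₁ M | c ∈ S₂ ∧ p • c = 0})
    (hker : Set.Finite {c : subgroupH1 H₂ M | p • c = 0 ∧ resOfLe M hle c = 0}) :
    Set.Finite {c : subgroupH1 H₂ M | c ∈ S₁ ∧ p • c = 0} := by
  refine finite_of_finite_image_of_sub_mem (f := resOfLe M hle) (hS₂.subset ?_) hker ?_
  · rintro _ ⟨c, hc, rfl⟩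
    exact ⟨hmap c hc.1, by rw [← map_nsmul, hc.2, map_zero]⟩
  · intro c hc c' hc' e
    exact ⟨by rw [smul_sub, hc.2, hc'.2, sub_zero], by rw [map_sub, e, sub_self]⟩

end Generic


/-! ## §2 Elliptic curves over a number field: the `p`-torsion inputs and the restriction into an upstairs fine Selmer group -/

section NumberField

open WeierstrassCurve NumberField IsDedekindDomain Field GreenbergSelmer

variable {K : Type} [Field K] [NumberField K] (W : WeierstrassCurve K) (p : ℕ) [Fact p.Prime]

omit [NumberField K] in
/-- `E[p^∞][p] = E[p]` is finite for an elliptic curve. [cite: SilvermanAEC2009, Cor. III.6.4] -/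
theorem finite_pTorsion_geomPrimaryTorsion [W.IsElliptic] :
    Set.Finite {m : W.geomPrimaryTorsion p | p • m = 0} := by
  haveI : Finite (geomTorsion W (p : ℕ)) := W.finite_geomTorsion_nat (Fact.out : p.Prime).ne_zero
  let f : {m : W.geomPrimaryTorsion p | p • m = 0} → geomTorsion W (p : ℕ) := fun m ↦
    ⟨((m : W.geomPrimaryTorsion p) : geomPoints W), AddSubgroup.torsionBy.nsmul_iff.mpr (by
      rw [← AddSubgroupClass.coe_nsmul, (show p • (m : W.geomPrimaryTorsion p) = 0 from m.2),
        ZeroMemClass.coe_zero])⟩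
  have hf : Function.Injective f := by
    intro x y hxy
    exact Subtype.ext (Subtype.ext (congrArg (fun z : geomTorsion W (p : ℕ) ↦ (z : geomPoints W)) hxy))
  haveI : Finite {m : W.geomPrimaryTorsion p | p • m = 0} := Finite.of_injective f hf
  exact Set.toFinite _

omit [NumberField K] in
/-- For every `H ≤ Γ_K` the group `N = E[p^∞]^H` of `H`-fixed `p`-power torsion points has FINITE `N/pN`: `N` is
`p`-primary with `N[p] ⊆ E[p]` finite (tree `finite_modN_of_primary`, the elementary shadow of «cofinitely generated»).
Lim 2017, proof of Lemma 3.2: «`W(L^{cyc})` … cofinitely generated». [cite: Lim2017FineSelmer, §3 Lemma 3.2 (arXiv:1306.2047 p. 6)] -/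
theorem finite_modN_fixedPoints_geomPrimaryTorsion [W.IsElliptic] (H : Subgroup (absoluteGaloisGroup K)) :
    Finite (ModN (FixedPoints.addSubgroup H (W.geomPrimaryTorsion p)) p) := by
  set N := FixedPoints.addSubgroup H (W.geomPrimaryTorsion p) with hN
  haveI : Finite {m : W.geomPrimaryTorsion p | p • m = 0} := (finite_pTorsion_geomPrimaryTorsion W p).to_subtype
  haveI : Finite (AddSubgroup.torsionBy N (p : ℤ)) := by
    let f : AddSubgroup.torsionBy N (p : ℤ) → {m : W.geomPrimaryTorsion p | p • m = 0} := fun x ↦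
      ⟨((x : N) : W.geomPrimaryTorsion p), by
        change p • ((x : N) : W.geomPrimaryTorsion p) = 0
        rw [← AddSubgroupClass.coe_nsmul, AddSubgroup.torsionBy.nsmul_iff.mp x.2, ZeroMemClass.coe_zero]⟩
    refine Finite.of_injective f fun x y hxy ↦ ?_
    have h : ((x : N) : W.geomPrimaryTorsion p) = ((y : N) : W.geomPrimaryTorsion p) :=
      congrArg (fun z : {m : W.geomPrimaryTorsion p | p • m = 0} ↦ (z : W.geomPrimaryTorsion p)) hxy
    exact Subtype.ext (Subtype.ext h)
  -- `N` is `p`-primary (`E[p^∞]` is, by definition of the primary component; cf. the tree's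
  -- `Rank1Residual.X2.LocalInertiaCohomologyMultiplicative.primary_curve`)
  have hC : ∀ c : N, ∃ n : ℕ, p ^ n • c = 0 := fun c ↦ by
    obtain ⟨n, hn⟩ := (AddCommGroup.mem_primaryComponent).1 (c : W.geomPrimaryTorsion p).2
    refine ⟨n, Subtype.ext (Subtype.ext ?_)⟩
    rw [AddSubgroupClass.coe_nsmul, AddSubmonoidClass.coe_nsmul, ZeroMemClass.coe_zero, ZeroMemClass.coe_zero]
    exact hn
  exact (finite_modN_of_primary hC).1

/-- **«No real place upstairs» for any `H ≤ ker χ_p`**: the condition "locally trivial at `w ∣ ∞`" on `H¹(H, M)` is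
vacuous (`H ⊓ D_w ≤ ker χ_p ⊓ D_w = ⊥`, att-p4 `InfResRel.ker_cyclotomicCharacter_inf_decompInf_eq_bot`: a complex
conjugation inverts `μ_{p^∞}`). [cite: MilneADT2006, Ch. I, Thm. 2.13] [cite: GreenbergLNM1716, §4 (PDF p. 106)] -/
theorem infKer_eq_top_of_le_kerCyclotomicCharacter (M : Type) [AddCommGroup M]
    [DistribMulAction (absoluteGaloisGroup K) M] [TopologicalSpace M] [DiscreteTopology M]
    {H : Subgroup (absoluteGaloisGroup K)} (hH : H ≤ (GaloisRep.cyclotomicCharacter K p).toMonoidHom.ker)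
    (w : InfinitePlace K) : infKer H M w = ⊤ := by
  rw [eq_top_iff]
  intro c _
  rw [infKer, AddMonoidHom.mem_ker]
  obtain ⟨ψ, hψ⟩ := oneCocycleClass_surjective _ (resOfLe M (inf_le_left : H ⊓ decompInf w ≤ _) c)
  rw [← hψ]
  have h0 : ψ = 0 := by
    apply Subtype.ext
    ext x
    have hx : x = 1 := by
      apply Subtype.ext
      have h : (x : absoluteGaloisGroup K) ∈ (⊥ : Subgroup (absoluteGaloisGroup K)) := by
        rw [← InfResRel.ker_cyclotomicCharacter_inf_decompInf_eq_bot K p w]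
        exact ⟨hH x.2.1, x.2.2⟩
      exact Subgroup.mem_bot.mp h
    rw [hx]
    exact contOneCocycles.apply_one ψ
  rw [h0, oneCocycleClass_zero]

variable (κ : ZpExtension K p)

/-- **The restriction `Sel₀^{rel ∞}(K_∞^{cyc}, E[p^∞]) → Sel₀(L, E[p^∞])` is DEFINED for every `L = K̄^H` between
`K(μ_{p^∞})` and `K̄`** (`H` normal, `H ≤ ker χ_p`): a class locally trivial at every finite place of `K_∞` restricts to a
class locally trivial at every finite place of `L` (functoriality, att-p4 `InfResRel.resOfLe_mem_awayKer`,
`LocalAway.strictKer_fineLocalDatum_eq_awayKer`), and at the infinite places of `L` there is no condition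
(`infKer_eq_top_of_le_kerCyclotomicCharacter`). Lim 2017, proof of Lemma 3.2 (the map `α`).
[cite: Lim2017FineSelmer, §3 Lemma 3.2 (arXiv:1306.2047 p. 6)] [cite: GreenbergLNM1716, §3 (restriction maps)] -/
theorem resOfLe_fineRelaxed_mem_strictSelmerGroupOver (hκ : κ.IsCyclotomic) {H : Subgroup (absoluteGaloisGroup K)}
    [H.Normal] (hH : H ≤ (GaloisRep.cyclotomicCharacter K p).toMonoidHom.ker)
    {c : W.subgroupH1 p κ.kerSubgroup} (hc : c ∈ W.fineSelmerInftyRelaxedInf κ) :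
    W.resOfLe p (hH.trans (InfRes.ker_cyclotomicCharacter_le_kerSubgroup κ hκ)) c ∈
      strictSelmerGroupOver H (W.geomPrimaryTorsion p) p (fineData (W.geomPrimaryTorsion p) p) := by
  set h := hH.trans (InfRes.ker_cyclotomicCharacter_le_kerSubgroup κ hκ) with hh
  have hc' := (mem_strictSelmerGroupOverRelaxedInf_iff (H := κ.kerSubgroup) (M := W.geomPrimaryTorsion p)
    (L := fineData (W.geomPrimaryTorsion p) p) c).1 hc
  have hcomm : ∀ σ : absoluteGaloisGroup K,
      W.conjH1 p _ σ (W.resOfLe p h c) = W.resOfLe p h (W.conjH1 p κ.kerSubgroup σ c) := fun σ ↦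
    (congrArg (fun f ↦ f c) (resOfLe_comp_conjH1_holds (M := geomPrimaryTorsion W p) h σ)).symm
  refine (mem_strictSelmerGroupOver_iff (H := H) (M := W.geomPrimaryTorsion p)
    (L := fineData (W.geomPrimaryTorsion p) p) _).2 ⟨fun v hv σ ↦ ?_, fun w σ ↦ ?_, fun v hv σ ↦ ?_⟩
  · rw [hcomm]
    exact InfResRel.resOfLe_mem_awayKer (W.geomPrimaryTorsion p) h v (hc'.1 v hv σ)
  · rw [infKer_eq_top_of_le_kerCyclotomicCharacter p (W.geomPrimaryTorsion p) hH]
    exact AddSubgroup.mem_top _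
  · change _ ∈ (fineLocalDatum (W.geomPrimaryTorsion p) v).strictKer _
    rw [LocalAway.strictKer_fineLocalDatum_eq_awayKer, hcomm]
    have h2 := hc'.2 v hv σ
    change _ ∈ (fineLocalDatum (W.geomPrimaryTorsion p) v).strictKer _ at h2
    rw [LocalAway.strictKer_fineLocalDatum_eq_awayKer] at h2
    exact InfResRel.resOfLe_mem_awayKer (W.geomPrimaryTorsion p) h v h2

/-- **DESCENT OF STATEMENT (A) (Lim 2017, Lemma 3.2, in the `p`-torsion form): if the fine Selmer group over an
upstairs field `L = K̄^H` (`H` normal, `K(μ_{p^∞}) ⊆ L`, `[L : K_∞^{cyc}] < ∞`) has finite `p`-torsion, then so has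
`Sel₀^{rel ∞}(K_∞^{cyc}, E[p^∞])`** — the RELAXED-at-`∞` fine Selmer group over the cyclotomic `ℤ_p`-extension. The
restriction (`resOfLe_fineRelaxed_mem_strictSelmerGroupOver`) has finitely many `p`-torsion kernel classes by
`p`-torsion inflation–restriction (`finite_pTorsion_ker_resOfLe`: `E[p]` finite, `E[p^∞]^{H}/p` finite).
[cite: Lim2017FineSelmer, §3 Lemma 3.2 (arXiv:1306.2047 p. 6)] [cite: CoatesSujatha2005, §3 (statement (A))] -/
theorem finite_pTorsion_fineRelaxed_of_upstairs [W.IsElliptic] (hκ : κ.IsCyclotomic)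
    {H : Subgroup (absoluteGaloisGroup K)} [H.Normal] (hH : H ≤ (GaloisRep.cyclotomicCharacter K p).toMonoidHom.ker)
    (hind : (H.subgroupOf κ.kerSubgroup).FiniteIndex)
    (hup : Set.Finite {c : W.subgroupH1 p H |
      c ∈ strictSelmerGroupOver H (W.geomPrimaryTorsion p) p (fineData (W.geomPrimaryTorsion p) p) ∧ p • c = 0}) :
    Set.Finite {s : W.fineSelmerInftyRelaxedInf κ | p • s = 0} := by
  set h := hH.trans (InfRes.ker_cyclotomicCharacter_le_kerSubgroup κ hκ) with hh
  have hker : Set.Finite {c : W.subgroupH1 p κ.kerSubgroup | p • c = 0 ∧ W.resOfLe p h c = 0} :=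
    finite_pTorsion_ker_resOfLe (M := W.geomPrimaryTorsion p) h
      (fun g _ x hx ↦ by simpa [mul_assoc] using (inferInstance : H.Normal).conj_mem x hx g⁻¹) hind
      (fun m ↦ W.continuous_smul_geomPrimaryTorsion p m) p
      (finite_modN_fixedPoints_geomPrimaryTorsion W p H) (finite_pTorsion_geomPrimaryTorsion W p)
  have hmain := finite_pTorsion_of_resOfLe_maps (M := W.geomPrimaryTorsion p) h p (W.fineSelmerInftyRelaxedInf κ)
    (strictSelmerGroupOver H (W.geomPrimaryTorsion p) p (fineData (W.geomPrimaryTorsion p) p))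
    (fun c hc ↦ resOfLe_fineRelaxed_mem_strictSelmerGroupOver W p κ hκ hH hc) hup hker
  refine Set.Finite.of_finite_image (hmain.subset ?_) Subtype.coe_injective.injOn
  rintro _ ⟨s, hs, rfl⟩
  refine ⟨s.2, ?_⟩
  have hs' : p • s = 0 := hs
  rw [← AddSubmonoidClass.coe_nsmul, hs', ZeroMemClass.coe_zero]

end NumberField

end Summit.BirchSwinnertonDyer.BirchSwinnertonDyer.Theorems.AlignedTransportAtTwoFineRoad.LimDescent

end
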